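import Literature.Probability.LatticeModels.RCContourModel
import Literature.Probability.LatticeModels.RCBoxGraph
import HarnessLib

/-!
# Random-cluster contours: ambient form of box configurations (bridge to the finite-graph measures)

Topic `Literature/Probability/LatticeModels`. Bookkeeping linking the tree's random-cluster measures
on finite subgraphs `finsetGraph (zdGraph d) Λ` (vertex type `↥Λ`, configurations `Finset (Sym2 ↥Λ)`,
cluster counts via `SimpleGraph.ConnectedComponent`) with the ambient lattice language of the contour
files (configurations `Finset (Sym2 (Site d))`, class counts `ccount`):

* `amb`: the ambient image of a configuration (as a `Finset.map`; it agrees with `ω.image liftE` of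
  `RCBoxGraph`, the `map` form carrying the cardinality/membership API used downstream); adjacency,
  reachability and the **number of connected components of `openGraph ω ⊔ wired B` equal the `ccount`
  of the wired open relation** (`natCard_connectedComponent_eq_ccount`), for an arbitrary wired set `B`
  (the wired box measures need `B = ∂Λ`, which the spine-graph dictionary of `RCBoxGraph` does not cover);
* geometry of boxes: inner boundaries, cores, inner volumes, and **the free edges of the volume
  `Λ_{N+3}` are the edges touching `Λ_N`** (`mem_freeEdges_box`).

Everything is proved; no named facts.

## References

* G. Grimmett, *The Random-Cluster Model*, Springer 2006, §4.2 (random-cluster measures on boxes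
  with boundary conditions). [Grimmett2006]
-/

noncomputable section

open Finset Relation SimpleGraph

namespace Literature.Probability.LatticeModels

namespace RCC

open ClassCount

variable {d : ℕ}

/-! ### Ambient configurations and relations -/

/-- The ambient image of a configuration of the subgraph on `Λ`. [folklore] -/
def amb {Λ : Finset (Site d)} (ωb : Finset (Sym2 ↥Λ)) : Finset (Sym2 (Site d)) :=
  ωb.map (Function.Embedding.subtype (· ∈ Λ)).sym2Map

/-- The open relation of an ambient configuration. [folklore] -/
def Rcfg (ω : Finset (Sym2 (Site d))) (a b : Site d) : Prop := (zdGraph d).Adj a b ∧ s(a, b) ∈ ω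

/-- `Rcfg` is symmetric. [folklore] -/
theorem rcfg_symm (ω : Finset (Sym2 (Site d))) : ∀ a b, Rcfg ω a b → Rcfg ω b a :=
  fun _ _ h => ⟨h.1.symm, by rw [Sym2.eq_swap]; exact h.2⟩

variable {Λ : Finset (Site d)}

/-- Membership of a pair in the ambient image. [folklore] -/
theorem mk_mem_amb_iff {ωb : Finset (Sym2 ↥Λ)} (x y : ↥Λ) : s(x.1, y.1) ∈ amb ωb ↔ s(x, y) ∈ ωb := by
  rw [amb, show s(x.1, y.1) = (Function.Embedding.subtype (· ∈ Λ)).sym2Map s(x, y) from rfl, mem_map' _]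

/-- Elements of the ambient image are pairs of points of `Λ`. [folklore] -/
theorem mem_of_mem_amb {ωb : Finset (Sym2 ↥Λ)} {e : Sym2 (Site d)} (he : e ∈ amb ωb) {z : Site d} (hz : z ∈ e) : z ∈ Λ := by
  obtain ⟨e', -, rfl⟩ := mem_map.1 he
  rw [Function.Embedding.sym2Map_apply, Sym2.mem_map] at hz
  obtain ⟨w, -, rfl⟩ := hz
  exact w.2

/-- Pairs in a sub-configuration of the edge set are edges. [folklore] -/
theorem adj_of_mk_mem {ωb : Finset (Sym2 ↥Λ)} (hω : ωb ⊆ (finsetGraph (zdGraph d) Λ).edgeFinset) {x y : ↥Λ}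
    (h : s(x, y) ∈ ωb) : (zdGraph d).Adj x.1 y.1 :=
  (finsetGraph_adj_iff x y).1 ((SimpleGraph.mem_edgeSet _).1 (mem_edgeFinset.1 (hω h)))

/-- **Adjacency in `openGraph ω ⊔ wired B` is the wired open relation of the ambient image.**
[cite: Grimmett2006, §4.2] -/
theorem adj_sup_wired_iff {ωb : Finset (Sym2 ↥Λ)} (hω : ωb ⊆ (finsetGraph (zdGraph d) Λ).edgeFinset) (Bf : Finset (Site d))
    (x y : ↥Λ) :
    (Percolation.openGraph (↑ωb : Set (Sym2 ↥Λ)) ⊔ wired {z : ↥Λ | z.1 ∈ Bf}).Adj x y ↔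
      x ≠ y ∧ wire (Rcfg (amb ωb)) Bf x.1 y.1 := by
  rw [sup_adj, Percolation.openGraph_adj, wired_adj, wire, Rcfg, mk_mem_amb_iff, mem_coe]
  simp only [Set.mem_setOf_eq]
  constructor
  · rintro (⟨h, hne⟩ | ⟨hne, hx, hy⟩)
    · exact ⟨hne, Or.inl ⟨adj_of_mk_mem hω h, h⟩⟩
    · exact ⟨hne, Or.inr ⟨hx, hy⟩⟩
  · rintro ⟨hne, ⟨-, h⟩ | ⟨hx, hy⟩⟩
    · exact Or.inl ⟨h, hne⟩
    · exact Or.inr ⟨hne, hx, hy⟩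

/-- **Reachability in `openGraph ω ⊔ wired B` is a chain of the wired open relation inside `Λ`.**
[cite: Grimmett2006, §4.2] -/
theorem reachable_sup_wired_iff {ωb : Finset (Sym2 ↥Λ)} (hω : ωb ⊆ (finsetGraph (zdGraph d) Λ).edgeFinset) (Bf : Finset (Site d))
    (x y : ↥Λ) :
    (Percolation.openGraph (↑ωb : Set (Sym2 ↥Λ)) ⊔ wired {z : ↥Λ | z.1 ∈ Bf}).Reachable x y ↔
      ReflTransGen (relIn (wire (Rcfg (amb ωb)) Bf) Λ) x.1 y.1 := by
  constructor
  · intro h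
    rw [SimpleGraph.reachable_iff_reflTransGen] at h
    induction h with
    | refl => exact ReflTransGen.refl
    | tail _ hbc ih => exact ih.tail ⟨((adj_sup_wired_iff hω Bf _ _).1 hbc).2, (by exact Subtype.prop _), (by exact Subtype.prop _)⟩
  · suffices key : ∀ b, ReflTransGen (relIn (wire (Rcfg (amb ωb)) Bf) Λ) x.1 b → ∀ hb : b ∈ Λ,
        (Percolation.openGraph (↑ωb : Set (Sym2 ↥Λ)) ⊔ wired {z : ↥Λ | z.1 ∈ Bf}).Reachable x ⟨b, hb⟩ by
      intro h; have := key y.1 h y.2; simpa using this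
    intro b hb
    induction hb with
    | refl => intro hb; exact ⟨by rw [show (⟨x.1, hb⟩ : ↥Λ) = x from Subtype.ext rfl]⟩
    | @tail b c _ hbc ih =>
      intro hc
      have hb : b ∈ Λ := hbc.2.1
      refine (ih hb).trans ?_
      by_cases hbc' : b = c
      · subst hbc'; exact Reachable.refl _
      · exact Adj.reachable ((adj_sup_wired_iff hω Bf ⟨b, hb⟩ ⟨c, hc⟩).2 ⟨fun h => hbc' (congrArg Subtype.val h), hbc.1⟩)

/-- **The number of connected components of `openGraph ω ⊔ wired B` on `↥Λ` is the class count of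
the wired open relation on `Λ`.** [cite: Grimmett2006, §1.2, eq. (1.1) and §4.2] -/
theorem natCard_connectedComponent_eq_ccount {ωb : Finset (Sym2 ↥Λ)} (hω : ωb ⊆ (finsetGraph (zdGraph d) Λ).edgeFinset)
    (Bf : Finset (Site d)) :
    Nat.card (Percolation.openGraph (↑ωb : Set (Sym2 ↥Λ)) ⊔ wired {z : ↥Λ | z.1 ∈ Bf}).ConnectedComponent =
      ccount (wire (Rcfg (amb ωb)) Bf) Λ := by
  classical
  set H := Percolation.openGraph (↑ωb : Set (Sym2 ↥Λ)) ⊔ wired {z : ↥Λ | z.1 ∈ Bf} with hH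
  set R := wire (Rcfg (amb ωb)) Bf with hR
  have hRs : ∀ a b, R a b → R b a := wire_symm (rcfg_symm _) _
  -- the class map on components
  have hcompat : ∀ (v w : ↥Λ), H.Reachable v w → cls R Λ v.1 = cls R Λ w.1 := fun v w hvw =>
    (cls_eq_of_mem hRs (mem_cls.2 ⟨w.2, (reachable_sup_wired_iff hω Bf v w).1 hvw⟩)).symm
  set f : H.ConnectedComponent → ↥(Λ.image (cls R Λ)) := ConnectedComponent.lift
    (fun v => ⟨cls R Λ v.1, mem_image_of_mem _ v.2⟩) (fun v w p _ => Subtype.ext (hcompat v w ⟨p⟩)) with hf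
  have hbij : Function.Bijective f := by
    constructor
    · refine ConnectedComponent.ind₂ fun v w h => ?_
      simp only [hf, ConnectedComponent.lift_mk, Subtype.mk.injEq] at h
      refine ConnectedComponent.sound ((reachable_sup_wired_iff hω Bf v w).2 ?_)
      have : w.1 ∈ cls R Λ v.1 := h ▸ mem_cls_self w.2
      exact (mem_cls.1 this).2
    · rintro ⟨K, hK⟩
      obtain ⟨v, hv, rfl⟩ := mem_image.1 hK
      exact ⟨H.connectedComponentMk ⟨v, hv⟩, by simp [hf]⟩
  rw [Nat.card_eq_of_bijective f hbij, Nat.card_eq_fintype_card, Fintype.card_coe, ccount]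

/-- The wired set of a finset of ambient vertices. [folklore] -/
theorem setOf_mem_empty : {z : ↥Λ | z.1 ∈ (∅ : Finset (Site d))} = (∅ : Set ↥Λ) := by
  ext z; simp

/-- **The tree's cluster count with a wired set given by ambient vertices is a `ccount`.**
[cite: Grimmett2006, §1.2, eq. (1.1) and §4.2] -/
theorem clusterCount_eq_ccount {ωb : Finset (Sym2 ↥Λ)} (hω : ωb ⊆ (finsetGraph (zdGraph d) Λ).edgeFinset) (Bf : Finset (Site d)) :
    clusterCount (↑ωb : Set (Sym2 ↥Λ)) {z : ↥Λ | z.1 ∈ Bf} = ccount (wire (Rcfg (amb ωb)) Bf) Λ :=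
  natCard_connectedComponent_eq_ccount hω Bf

/-- The free cluster count. [cite: Grimmett2006, §1.2, eq. (1.1)] -/
theorem clusterCount_empty_eq_ccount {ωb : Finset (Sym2 ↥Λ)} (hω : ωb ⊆ (finsetGraph (zdGraph d) Λ).edgeFinset) :
    clusterCount (↑ωb : Set (Sym2 ↥Λ)) (∅ : Set ↥Λ) = ccount (Rcfg (amb ωb)) Λ := by
  rw [← setOf_mem_empty, clusterCount_eq_ccount hω ∅]
  exact ccount_congr fun a _ b _ => by rw [wire]; simp

/-- **The edges of the subgraph on `Λ` are the nearest-neighbour edges inside `Λ`.** [cite: Grimmett2006, §4.2 (E_Λ)] -/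
theorem map_edgeFinset_eq_nnEdges (Λ : Finset (Site d)) :
    (finsetGraph (zdGraph d) Λ).edgeFinset.map (Function.Embedding.subtype (· ∈ Λ)).sym2Map = nnEdges Λ := by
  ext e
  rw [mem_map]
  constructor
  · rintro ⟨e', he', rfl⟩
    induction e' using Sym2.ind with
    | h x y =>
      rw [Function.Embedding.sym2Map_apply, Sym2.map_mk]
      exact mk_mem_nnEdges.2 ⟨(finsetGraph_adj_iff x y).1 ((SimpleGraph.mem_edgeSet _).1 (mem_edgeFinset.1 he')), x.2, y.2⟩
  · intro he
    induction e using Sym2.ind with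
    | h a b =>
      obtain ⟨hab, ha, hb⟩ := mk_mem_nnEdges.1 he
      exact ⟨s(⟨a, ha⟩, ⟨b, hb⟩), mem_edgeFinset.2 ((SimpleGraph.mem_edgeSet _).2 ((finsetGraph_adj_iff _ _).2 hab)), rfl⟩

/-- Ambient images of sub-configurations of the edge set are sub-configurations of `nnEdges Λ`. [folklore] -/
theorem amb_subset_nnEdges {ωb : Finset (Sym2 ↥Λ)} (hω : ωb ⊆ (finsetGraph (zdGraph d) Λ).edgeFinset) : amb ωb ⊆ nnEdges Λ := by
  rw [← map_edgeFinset_eq_nnEdges]; exact map_subset_map.2 hω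

/-- The preimage configuration of an ambient configuration. [folklore] -/
def unamb (Λ : Finset (Site d)) (ω : Finset (Sym2 (Site d))) : Finset (Sym2 ↥Λ) :=
  (finsetGraph (zdGraph d) Λ).edgeFinset.filter fun e => (Function.Embedding.subtype (· ∈ Λ)).sym2Map e ∈ ω

/-- `unamb` lands in the edge set. [folklore] -/
theorem unamb_subset (ω : Finset (Sym2 (Site d))) : unamb Λ ω ⊆ (finsetGraph (zdGraph d) Λ).edgeFinset := filter_subset _ _

/-- `unamb ∘ amb = id` on sub-configurations of the edge set. [folklore] -/
theorem unamb_amb {ωb : Finset (Sym2 ↥Λ)} (hω : ωb ⊆ (finsetGraph (zdGraph d) Λ).edgeFinset) : unamb Λ (amb ωb) = ωb := by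
  ext e
  rw [unamb, mem_filter, amb, mem_map' _]
  exact ⟨fun h => h.2, fun h => ⟨hω h, h⟩⟩

/-- `amb ∘ unamb = id` on sub-configurations of `nnEdges Λ`. [folklore] -/
theorem amb_unamb {ω : Finset (Sym2 (Site d))} (hω : ω ⊆ nnEdges Λ) : amb (unamb Λ ω) = ω := by
  ext e
  rw [amb, mem_map]
  constructor
  · rintro ⟨e', he', rfl⟩; exact (mem_filter.1 he').2
  · intro he
    have := hω he
    rw [← map_edgeFinset_eq_nnEdges, mem_map] at this
    obtain ⟨e', he', rfl⟩ := this
    exact ⟨e', mem_filter.2 ⟨he', he⟩, rfl⟩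

/-- `amb` is injective. [folklore] -/
theorem card_amb (ωb : Finset (Sym2 ↥Λ)) : #(amb ωb) = #ωb := card_map _

/-- **Sums over sub-configurations of the edge set are sums over sub-configurations of `nnEdges Λ`.** [folklore] -/
theorem sum_powerset_edgeFinset_eq (f : Finset (Sym2 (Site d)) → ℝ) :
    ∑ ωb ∈ (finsetGraph (zdGraph d) Λ).edgeFinset.powerset, f (amb ωb) = ∑ ω ∈ (nnEdges Λ).powerset, f ω :=
  sum_nbij' amb (unamb Λ) (fun _ hωb => mem_powerset.2 (amb_subset_nnEdges (mem_powerset.1 hωb)))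
    (fun ω _ => mem_powerset.2 (unamb_subset ω)) (fun _ hωb => unamb_amb (mem_powerset.1 hωb))
    (fun _ hω => amb_unamb (mem_powerset.1 hω)) (fun _ _ => rfl)

/-! ### Geometry of boxes -/

/-- **The inner vertex boundary of a box**: the points with a coordinate of modulus `n`. [cite: Grimmett2006, §4.2 (∂Λ)] -/
theorem mem_innerBoundary_box {n : ℕ} {x : Site d} :
    x ∈ innerBoundary (zdGraph d) (box d n) ↔ x ∈ box d n ∧ ∃ i, (x i).natAbs = n := by
  rw [innerBoundary, mem_filter]
  refine and_congr_right fun hx => ?_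
  rw [mem_box] at hx
  constructor
  · rintro ⟨y, hy, hyb⟩
    rw [mem_neighborFinset, zdGraph_adj_iff] at hy
    obtain ⟨i, h⟩ := hy
    refine ⟨i, ?_⟩
    have hxi := hx i
    rw [mem_box, not_forall] at hyb
    obtain ⟨j, hj⟩ := hyb
    rcases h with rfl | h
    · by_cases hji : j = i
      · subst hji; simp at hj; omega
      · have := hx j; simp [Pi.single_eq_of_ne hji] at hj; omega
    · have hy : y = x - Pi.single i 1 := by rw [h]; simp
      subst hy
      by_cases hji : j = i
      · subst hji; simp at hj; omega
      · have := hx j; simp [Pi.single_eq_of_ne hji] at hj; omega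
  · rintro ⟨i, hi⟩
    have hxi := hx i
    by_cases hpos : 0 ≤ x i
    · refine ⟨x + Pi.single i 1, (mem_neighborFinset _ _ _).2 ((zdGraph_adj_iff _ _).2 ⟨i, Or.inl rfl⟩), fun h => ?_⟩
      have := (mem_box.1 h) i; simp at this; omega
    · refine ⟨x - Pi.single i 1, (mem_neighborFinset _ _ _).2 ((zdGraph_adj_iff _ _).2 ⟨i, Or.inr (by simp)⟩), fun h => ?_⟩
      have := (mem_box.1 h) i; simp at this; omega

/-- The inner boundary of `Λ_{N+1}` is `Λ_{N+1} ∖ Λ_N`. [cite: Grimmett2006, §4.2] -/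
theorem innerBoundary_box_succ (N : ℕ) : innerBoundary (zdGraph d) (box d (N + 1)) = box d (N + 1) \ box d N := by
  ext x
  rw [mem_innerBoundary_box, mem_sdiff, mem_box, mem_box]
  refine and_congr_right fun hx => ?_
  constructor
  · rintro ⟨i, hi⟩ h; have := h i; omega
  · intro h
    rw [not_forall] at h
    obtain ⟨i, hi⟩ := h
    exact ⟨i, by have := hx i; omega⟩

/-- The ball of a point of `Λ_N` lies in `Λ_{N+1}`. [folklore] -/
theorem starBall_subset_box_succ {N : ℕ} {x : Site d} (hx : x ∈ box d N) : starBall x ⊆ box d (N + 1) := by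
  intro y hy
  rw [mem_starBall, supDist_le_iff] at hy
  rw [mem_box] at hx ⊢
  intro i; have := hx i; have := hy i; push_cast; omega

/-- **The free edges of `Λ_{N+3}` are the edges touching `Λ_N`.** [cite: FriedliVelenik2017, §7.3 (Ω^#_Λ) adapted] -/
theorem mem_freeEdges_box {N : ℕ} {e : Sym2 (Site d)} :
    e ∈ freeEdges (box d (N + 3)) ↔ e ∈ (zdGraph d).edgeSet ∧ ∃ z, z ∈ e ∧ z ∈ box d N := by
  rw [mem_freeEdges, show N + 3 = (N + 1) + 2 from by ring, core_box]
  refine and_congr_right fun he => ⟨fun hc => ?_, fun ⟨z, hz, hzN⟩ => ?_⟩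
  · -- if no endpoint is in `Λ_N`, some co-ball point lies outside `Λ_{N+1}`
    by_contra hno
    push Not at hno
    induction e using Sym2.ind with
    | h x y =>
      have hxy : (zdGraph d).Adj x y := (SimpleGraph.mem_edgeSet _).1 he
      have hx : x ∉ box d N := hno x (Sym2.mem_mk_left x y)
      have hy : y ∉ box d N := hno y (Sym2.mem_mk_right x y)
      have hxB : x ∈ box d (N + 1) := hc (mem_coBall_of_mem he (Sym2.mem_mk_left x y))
      have hyB : y ∈ box d (N + 1) := hc (mem_coBall_of_mem he (Sym2.mem_mk_right x y))
      -- a generic outward push: for an endpoint `z` with `|z i| = N+1` and the other endpoint not differing at `i`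
      have push : ∀ (z z' : Site d), (z = x ∧ z' = y ∨ z = y ∧ z' = x) → ∀ i, (z i).natAbs = N + 1 → z' i = z i → False := by
        intro z z' hzz' i hzi hz'i
        set w : Site d := Function.update z i (z i + if 0 ≤ z i then 1 else -1) with hw
        have hwz : w ∈ starBall z := by
          rw [mem_starBall, supDist_le_iff]; intro j
          by_cases hj : j = i
          · subst hj; simp only [hw, Function.update_self]; split_ifs <;> omega
          · simp [hw, Function.update_of_ne hj]
        have hzz'1 : supDist z z' ≤ 1 := by
          rcases hzz' with ⟨rfl, rfl⟩ | ⟨rfl, rfl⟩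
          · exact (zdStar_adj.1 (zdGraph_le_zdStar hxy)).2
          · exact (zdStar_adj.1 (zdGraph_le_zdStar hxy.symm)).2
        have hwz' : w ∈ starBall z' := by
          rw [supDist_le_iff] at hzz'1
          rw [mem_starBall, supDist_le_iff]
          intro j
          by_cases hj : j = i
          · subst hj; simp only [hw, Function.update_self]; rw [hz'i]; split_ifs <;> omega
          · simp only [hw, Function.update_of_ne hj]; have := hzz'1 j; omega
        have hwc : w ∈ coBall s(x, y) := by
          rw [coBall_mk, mem_inter]
          rcases hzz' with ⟨rfl, rfl⟩ | ⟨rfl, rfl⟩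
          · exact ⟨hwz, hwz'⟩
          · exact ⟨hwz', hwz⟩
        have := (mem_box.1 (hc hwc)) i
        simp only [hw, Function.update_self] at this
        split_ifs at this <;> omega
      -- `x ∉ Λ_N`: a coordinate `i` with `|x i| = N+1`
      obtain ⟨i, hi⟩ : ∃ i, (x i).natAbs = N + 1 := by
        rw [mem_box, not_forall] at hx
        obtain ⟨i, hi⟩ := hx
        exact ⟨i, by have := (mem_box.1 hxB) i; omega⟩
      obtain ⟨j, hj⟩ := (zdGraph_adj_iff x y).1 hxy
      by_cases hji : j = i
      · subst hji
        -- `y` differs from `x` at `i`; then `|y i| = N` and `y` has another maximal coordinate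
        have hyi : y j = x j + 1 ∨ y j = x j - 1 := by
          rcases hj with rfl | h
          · left; simp
          · right; rw [h]; simp
        have hyN : (y j).natAbs = N := by
          have := (mem_box.1 hyB) j; rcases hyi with h | h <;> rw [h] at this ⊢ <;> omega
        obtain ⟨i', hi'⟩ : ∃ i', (y i').natAbs = N + 1 := by
          rw [mem_box, not_forall] at hy
          obtain ⟨i', hi'⟩ := hy
          exact ⟨i', by have := (mem_box.1 hyB) i'; omega⟩
        have hi'j : i' ≠ j := fun h => by rw [h] at hi'; omega
        refine push y x (Or.inr ⟨rfl, rfl⟩) i' hi' ?_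
        rcases hj with rfl | h
        · simp [Pi.single_eq_of_ne hi'j]
        · rw [h]; simp [Pi.single_eq_of_ne hi'j]
      · refine push x y (Or.inl ⟨rfl, rfl⟩) i hi ?_
        rcases hj with rfl | h
        · simp [Pi.single_eq_of_ne (Ne.symm hji)]
        · rw [h]; simp [Pi.single_eq_of_ne (Ne.symm hji)]
  · -- an endpoint in `Λ_N`: the co-ball lies in its ball, inside `Λ_{N+1}`
    intro w hw
    exact starBall_subset_box_succ hzN (mem_starBall_comm.1 (mem_coBall_iff.1 hw z hz))

/-- Free edges of `Λ_{N+3}` lie inside `Λ_{N+1}`. [folklore] -/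
theorem freeEdges_box_subset_nnEdges (N : ℕ) : freeEdges (box d (N + 3)) ⊆ nnEdges (box d (N + 1)) := by
  intro e he
  obtain ⟨heE, z, hz, hzN⟩ := mem_freeEdges_box.1 he
  refine mem_nnEdges.2 ⟨heE, fun w hw => ?_⟩
  induction e using Sym2.ind with
  | h x y =>
    have hxy := (SimpleGraph.mem_edgeSet _).1 heE
    have hball : ∀ {a b : Site d}, (zdGraph d).Adj a b → a ∈ box d N → b ∈ box d (N + 1) := fun hab ha =>
      starBall_subset_box_succ ha ((adj_iff_mem_starBall.1 (zdGraph_le_zdStar hab)).1)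
    rcases Sym2.mem_iff.1 hz with rfl | rfl <;> rcases Sym2.mem_iff.1 hw with rfl | rfl
    · exact box_mono d (Nat.le_succ N) hzN
    · exact hball hxy hzN
    · exact hball hxy.symm hzN
    · exact box_mono d (Nat.le_succ N) hzN

/-- The complement of a box is `★`-connected. [folklore] -/
theorem starConn_compl_box (hd : 2 ≤ d) (n : ℕ) : StarConn ((box d n : Finset (Site d)) : Set (Site d))ᶜ := by
  have : ((box d n : Finset (Site d)) : Set (Site d))ᶜ = farSet d n := by
    ext x; rw [Set.mem_compl_iff, mem_coe, mem_farSet_iff_not_mem_box]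
  rw [this]; exact starConn_farSet hd n

end RCC

end Literature.Probability.LatticeModels

end
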